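import Literature.Probability.Percolation.InequalitiesProofs
import HarnessLib

/-!
# The BK inequality for the number of disjointly occurring events (Baron–Kahn 2019)

Topic `Literature/Probability/LatticeModels`. Source: J. D. Baron, J. Kahn, *A natural extension of
the BK inequality*, arXiv:1905.02883 (2019) [BaronKahn2019] (read: pp. 1–4 of the arXiv text,
Theorem 1 with its proof in §2).

**Printed statement** (§1, Theorem 1): "Let `(Ω, μ) = ∏_{i=1}^n (Ω_i, μ_i)` be a finite product
probability space with the `Ω_i`'s partially ordered and the `μ_i`'s PA. Given `A_1, …, A_k ⊂ Ω`, let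
`X = max{|I| : I ⊆ [k] and □_{i∈I} A_i occurs}`. Let `Y_1, …, Y_k` be independent Bernoullis with
`E Y_i = Pr(A_i)`, `Y = Σ Y_i` … If the `A_i`'s are all increasing, or all decreasing, then `X ≼ Y`"
(stochastic domination: `Pr(X ≥ r) ≤ Pr(Y ≥ r)` for every `r`). Here "`A_1, …, A_k` occur disjointly at
`ω`" means (p. 1) "there are disjoint `S_1, …, S_k ⊂ [n]` such that for each `i ∈ [k]` and `ω' ∈ Ω`, we
have `ω' ∈ A_i` whenever `ω'` agrees with `ω` on `S_i`"; Remark (i): `k = 2`, `r = 2` is the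
van den Berg–Kesten inequality.

We transcribe the case `Ω_i = {0,1}` (every measure on a two-point chain is PA; this is the
percolation case of Remark (i)), for increasing events, on the weighted cube of the tree's
`Literature.Probability.Percolation.bk_inequality_cube`: a finite coordinate type `α`, a finite
index type `κ` for the events, events `A : κ → Set (α → Bool)` that are upper sets, and a product
weight `W(x) = ∏ᵢ wᵢ(xᵢ)`, `wᵢ ≥ 0`. The random variable `Y` is realised on `κ` independent copies
`y : κ → (α → Bool)` of the cube as `Y(y) = #{j | y j ∈ A j}` (independent indicators with means
`W(A j)/W(Γ)`), so "`Pr(Y ≥ r)`" is the product weight of `{y | r ≤ #{j | y j ∈ A j}}`; the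
Poisson-binomial formula for it is `sum_atLeastCount_eq` below.
-- TODO(general form): PA marginals `μ_i` on arbitrary finite posets `Ω_i`; decreasing events (by symmetry).

## The printed proof, followed here (§2, "Proof of Theorem 1" and its Claim)

Baron–Kahn induct on the number `ψ(𝒜)` of coordinates affecting at least two events, replacing one
such coordinate by `k` independent private copies, one per event (`B_j` reads `ω_{n+j}` instead of
`ω_1`), and prove the one-coordinate Claim `μ(X_𝒜 ≥ r | ω_{[2,n]} = y) ≤ μ*(X_ℬ ≥ r | ω_{[2,n]} = y)`
by the case analysis "`X_ℬ(y) = X_𝒜(y) ≤ X_𝒜(ω) ≤ X_𝒜(y) + 1`" and the increasing sets `f_i` of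
values of the replaced coordinate that complete an `r`-family using that coordinate in the witness of
`A_i`. We run the same replacement as a CHAIN over the set `M ⊆ α` of already-privatised coordinates
(exactly as the tree's proof of `bk_inequality_cube` runs Grimmett's chain over `S`), on the big cube
`(α → Bool) × (κ → α → Bool)` = (shared copy `x`, private copies `y j`) with the product weight
`W(x) ∏_j W(y j)`:

* `hybrid A r M` — the event "`≥ r` of the events occur, event `j` being witnessed by a
  sub-configuration `K j ∈ A j` below the MIXED configuration (`y j` on `M`, `x` off `M`), the witnesses
  pairwise disjoint OFF `M`" (`M = ∅`: `≥ r` events occur disjointly at `x`, `mem_hybrid_empty`;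
  `M = univ`: `r ≤ #{j | y j ∈ A j}`, `mem_hybrid_univ`);
* `sum_block_split` — conditioning on everything except the `1 + |κ|` bits at one coordinate `i`
  (the printed "`| ω_{[2,n]} = y`");
* `block_four_point` — the printed Claim on that block: if the old event holds with the shared bit
  `0` then the new event holds identically (witnesses cannot use a `0`), and if it holds with the
  shared bit `1` via a family whose member `j₀` uses coordinate `i`, then the new event holds whenever
  the private bit of `j₀` is `1` (`hybrid_transfer`); the two bits have the same weight, so the block
  sums compare (for `Ω_i = {0,1}` the PA step `μ_1(∪ f_j) ≤ 1 - ∏ μ_1(f̄_j)` is this bijection);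
* `hybrid_sum_mono`, `hybrid_sum_empty_le` — the chain; `maxDisjoint_weight_le` — its two ends:
  `W(X ≥ r) · W^{⊗κ}(Γ^κ) ≤ W(Γ) · W^{⊗κ}(Y ≥ r)`;
* `maxDisjoint_le_count` — probability weights (`wᵢ(0) + wᵢ(1) = 1`): `P(X ≥ r) ≤ P^{⊗κ}(Y ≥ r)`;
* `sum_atLeastCount_eq` — `P^{⊗κ}(Y ≥ r) = Σ_{J ⊆ κ, |J| ≥ r} ∏_{j∈J} P(A j) ∏_{j∉J} (1 - P(A j))`
  (the law of a sum of independent Bernoullis), and `BaronKahn2019_thm1` — the printed form.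

Not transcribed: Theorem 3 (arbitrary events on linearly ordered factors, a Chernoff-type tail bound
via Reimer's inequality and Markov) and the Chernoff bound of Remark (iii).

## References

* J. D. Baron, J. Kahn, *A natural extension of the BK inequality*, arXiv:1905.02883 (2019), Thm. 1
  and §2. [BaronKahn2019]
* J. van den Berg, H. Kesten, *Inequalities with applications to percolation and reliability*,
  J. Appl. Probab. 22 (1985) 556–569 (the case `k = r = 2`; tree: `bk_inequality_cube`).
  [vandenBergKestenJAP1985]
-/

namespace Literature.Probability.LatticeModels

namespace BaronKahn2019

open Finset Function

variable {α : Type*} [Fintype α] [DecidableEq α] {κ : Type*} [Fintype κ] [DecidableEq κ]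

/-! ### The objects -/

/-- **Disjoint occurrence of a family of increasing events** on the cube `α → Bool`: the events
`A j`, `j ∈ I`, occur disjointly at `x` when there are sub-configurations `K j` of `x` (every `1` of
`K j` is a `1` of `x`) with `K j ∈ A j` and pairwise disjoint supports. For increasing events this is
the printed notion (a witness set `S_j` may be taken to be the set of `1`s of `x` it contains, and
conversely the support of `K j` witnesses `x ∈ A j`). [cite: BaronKahn2019, §1 (definition of □_{i∈I} A_i)] -/
def OccurDisjointly (A : κ → Set (α → Bool)) (I : Finset κ) (x : α → Bool) : Prop :=
  ∃ K : κ → α → Bool, (∀ j ∈ I, K j ∈ A j) ∧ (∀ j ∈ I, ∀ i, K j i = true → x i = true) ∧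
    (∀ j ∈ I, ∀ j' ∈ I, j ≠ j' → ∀ i, K j i = true → K j' i = true → False)

omit [Fintype κ] [DecidableEq κ] in
/-- **The printed definition.** For increasing events, `OccurDisjointly` is Baron–Kahn's
"`A_j` (`j ∈ I`) occur disjointly at `x`": "there are disjoint `S_j` such that for each `j` and
`ω' ∈ Ω`, we have `ω' ∈ A_j` whenever `ω'` agrees with `ω` on `S_j`" (the direction from witness
sets to sub-configurations holds for arbitrary events: restrict `x` to `S_j` and pad with `0`s).
[cite: BaronKahn2019, §1 (definition of disjoint occurrence)] -/
theorem occurDisjointly_iff_witness {A : κ → Set (α → Bool)} (hA : ∀ j, IsUpperSet (A j))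
    (I : Finset κ) (x : α → Bool) :
    OccurDisjointly A I x ↔ ∃ S : κ → Finset α,
      (∀ j ∈ I, ∀ j' ∈ I, j ≠ j' → Disjoint (S j) (S j')) ∧
      (∀ j ∈ I, ∀ x' : α → Bool, (∀ i ∈ S j, x' i = x i) → x' ∈ A j) := by
  constructor
  · rintro ⟨K, hKA, hKle, hdisj⟩
    refine ⟨fun j => univ.filter fun i => K j i = true, ?_, ?_⟩
    · intro j hj j' hj' hne
      rw [Finset.disjoint_left]
      intro i hi hi'
      exact hdisj j hj j' hj' hne i (Finset.mem_filter.1 hi).2 (Finset.mem_filter.1 hi').2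
    · intro j hj x' hx'
      refine hA j ?_ (hKA j hj)
      intro i
      by_cases hK : K j i = true
      · have h1 : x' i = x i := hx' i (Finset.mem_filter.2 ⟨Finset.mem_univ i, hK⟩)
        rw [hK, h1, hKle j hj i hK]
      · rw [Bool.not_eq_true] at hK
        rw [hK]
        exact Bool.false_le _
  · rintro ⟨S, hS, hSA⟩
    refine ⟨fun j i => if i ∈ S j then x i else false, ?_, ?_, ?_⟩
    · intro j hj
      exact hSA j hj _ fun i hi => by simp [hi]
    · intro j hj i hK
      by_cases hi : i ∈ S j
      · simpa [hi] using hK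
      · simp [hi] at hK
    · intro j hj j' hj' hne i hK hK'
      by_cases hi : i ∈ S j
      · by_cases hi' : i ∈ S j'
        · exact Finset.disjoint_left.1 (hS j hj j' hj' hne) hi hi'
        · simp [hi'] at hK'
      · simp [hi] at hK

/-- The event `{X ≥ r}`: some `r` of the events `A j` occur disjointly
(`X = max{|I| : □_{i∈I} A_i occurs}`). [cite: BaronKahn2019, Thm. 1 (the variable X)] -/
def atLeastDisjoint (A : κ → Set (α → Bool)) (r : ℕ) : Set (α → Bool) :=
  {x | ∃ I : Finset κ, r ≤ I.card ∧ OccurDisjointly A I x}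

/-- The event `{Y ≥ r}` on `κ` independent copies `y : κ → (α → Bool)` of the cube: at least `r`
indices `j` with `y j ∈ A j` (`Y = Σ_j 1{y j ∈ A j}`, a sum of independent Bernoullis with means
`P(A j)`). [cite: BaronKahn2019, Thm. 1 (the variable Y)] -/
def atLeastCount (A : κ → Set (α → Bool)) (r : ℕ) : Set (κ → α → Bool) :=
  {y | ∃ I : Finset κ, r ≤ I.card ∧ ∀ j ∈ I, y j ∈ A j}

/-- **The hybrid events of the chain.** On the big cube `(x, y) : (α → Bool) × (κ → α → Bool)` and
for a set `M` of privatised coordinates: `≥ r` of the events hold, event `j` witnessed by a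
sub-configuration `K j ∈ A j` of the mixed configuration "`y j` on `M`, `x` off `M`", the witnesses
being pairwise disjoint off `M` (Baron–Kahn's events `B_j` after replacing the coordinates of `M` by
private copies). [cite: BaronKahn2019, §2 (the events B_j and X_ℬ)] -/
def hybrid (A : κ → Set (α → Bool)) (r : ℕ) (M : Finset α) :
    Set ((α → Bool) × (κ → α → Bool)) :=
  {z | ∃ I : Finset κ, r ≤ I.card ∧ ∃ K : κ → α → Bool, (∀ j ∈ I, K j ∈ A j) ∧
      (∀ j ∈ I, ∀ i, K j i = true → (i ∈ M → z.2 j i = true) ∧ (i ∉ M → z.1 i = true)) ∧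
      (∀ j ∈ I, ∀ j' ∈ I, j ≠ j' → ∀ i, i ∉ M → K j i = true → K j' i = true → False)}

omit [Fintype α] [DecidableEq α] [Fintype κ] [DecidableEq κ] in
/-- Membership in `hybrid`. [cite: BaronKahn2019, §2] -/
theorem mem_hybrid {A : κ → Set (α → Bool)} {r : ℕ} {M : Finset α}
    {z : (α → Bool) × (κ → α → Bool)} :
    z ∈ hybrid A r M ↔ ∃ I : Finset κ, r ≤ I.card ∧ ∃ K : κ → α → Bool, (∀ j ∈ I, K j ∈ A j) ∧
      (∀ j ∈ I, ∀ i, K j i = true → (i ∈ M → z.2 j i = true) ∧ (i ∉ M → z.1 i = true)) ∧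
      (∀ j ∈ I, ∀ j' ∈ I, j ≠ j' → ∀ i, i ∉ M → K j i = true → K j' i = true → False) :=
  Iff.rfl

omit [Fintype α] [DecidableEq α] [Fintype κ] [DecidableEq κ] in
/-- At `M = ∅` the hybrid event is `{X ≥ r} × Γ^κ`. [cite: BaronKahn2019, §2 (X_𝒜)] -/
theorem mem_hybrid_empty {A : κ → Set (α → Bool)} {r : ℕ} {z : (α → Bool) × (κ → α → Bool)} :
    z ∈ hybrid A r ∅ ↔ z.1 ∈ atLeastDisjoint A r := by
  rw [mem_hybrid]
  constructor
  · rintro ⟨I, hr, K, hKA, hKle, hdisj⟩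
    exact ⟨I, hr, K, hKA, fun j hj i hi => (hKle j hj i hi).2 (Finset.notMem_empty i),
      fun j hj j' hj' hjj' i h1 h2 => hdisj j hj j' hj' hjj' i (Finset.notMem_empty i) h1 h2⟩
  · rintro ⟨I, hr, K, hKA, hKle, hdisj⟩
    exact ⟨I, hr, K, hKA, fun j hj i hi => ⟨fun h => absurd h (Finset.notMem_empty i),
      fun _ => hKle j hj i hi⟩, fun j hj j' hj' hjj' i _ h1 h2 => hdisj j hj j' hj' hjj' i h1 h2⟩

omit [DecidableEq α] [Fintype κ] [DecidableEq κ] in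
/-- At `M = univ` the hybrid event is `Γ × {Y ≥ r}` (for increasing events: a sub-configuration of
`y j` lying in `A j` forces `y j ∈ A j`). [cite: BaronKahn2019, §2 ("the laws of X and Y agree" when ψ = 0)] -/
theorem mem_hybrid_univ {A : κ → Set (α → Bool)} (hA : ∀ j, IsUpperSet (A j)) {r : ℕ}
    {z : (α → Bool) × (κ → α → Bool)} :
    z ∈ hybrid A r Finset.univ ↔ z.2 ∈ atLeastCount A r := by
  rw [mem_hybrid]
  constructor
  · rintro ⟨I, hr, K, hKA, hKle, -⟩
    refine ⟨I, hr, fun j hj => hA j ?_ (hKA j hj)⟩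
    intro i
    have h := fun hi => (hKle j hj i hi).1 (Finset.mem_univ i)
    revert h
    cases K j i <;> cases z.2 j i <;> simp
  · rintro ⟨I, hr, hI⟩
    exact ⟨I, hr, z.2, hI, fun j _ i hi => ⟨fun _ => hi, fun h => absurd (Finset.mem_univ i) h⟩,
      fun j _ j' _ _ i hi _ _ => absurd (Finset.mem_univ i) hi⟩

/-! ### Conditioning on the block of bits at one coordinate -/

/-- Overwrite the `1 + |κ|` bits at coordinate `i` of a big configuration: the shared bit by `b`,
the private bit of copy `j` by `c j`. [folklore] -/
def upd (i : α) (z : (α → Bool) × (κ → α → Bool)) (b : Bool) (c : κ → Bool) :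
    (α → Bool) × (κ → α → Bool) :=
  (update z.1 i b, fun j => update (z.2 j) i (c j))

omit [Fintype α] [Fintype κ] [DecidableEq κ] in
/-- The shared copy after overwriting the block. [folklore] -/
@[simp] theorem upd_fst (i : α) (z : (α → Bool) × (κ → α → Bool)) (b : Bool) (c : κ → Bool) :
    (upd i z b c).1 = update z.1 i b := rfl

omit [Fintype α] [Fintype κ] [DecidableEq κ] in
/-- The private copies after overwriting the block. [folklore] -/
@[simp] theorem upd_snd (i : α) (z : (α → Bool) × (κ → α → Bool)) (b : Bool) (c : κ → Bool)
    (j : κ) : (upd i z b c).2 j = update (z.2 j) i (c j) := rfl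

omit [Fintype α] [Fintype κ] [DecidableEq κ] in
/-- Overwriting twice is overwriting once. [folklore] -/
theorem upd_upd (i : α) (z : (α → Bool) × (κ → α → Bool)) (b b' : Bool) (c c' : κ → Bool) :
    upd i (upd i z b c) b' c' = upd i z b' c' := by
  unfold upd
  simp only [update_idem]

omit [Fintype α] [Fintype κ] [DecidableEq κ] in
/-- Overwriting by the present values does nothing. [folklore] -/
theorem upd_eq_self {i : α} {z : (α → Bool) × (κ → α → Bool)} {b : Bool} {c : κ → Bool}
    (hb : z.1 i = b) (hc : ∀ j, z.2 j i = c j) : upd i z b c = z := by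
  unfold upd
  refine Prod.ext ?_ ?_
  · exact update_eq_self_iff.2 hb.symm
  · funext j
    exact update_eq_self_iff.2 (hc j).symm

/-- **Splitting a sum over big configurations along the block at `i`** (the printed conditioning
"`μ(· | ω_{[2,n]} = y)`"): `Σ_z H(z) = Σ_{z : block(z) = 0} Σ_{b,c} H(upd i z b c)`. [folklore] -/
theorem sum_block_split (i : α) (H : (α → Bool) × (κ → α → Bool) → ℝ) :
    ∑ z, H z = ∑ z : (α → Bool) × (κ → α → Bool),
      if z.1 i = false ∧ (fun j => z.2 j i) = (fun _ => false) then
        ∑ b, ∑ c : κ → Bool, H (upd i z b c) else 0 := by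
  have fiber : ∀ z : (α → Bool) × (κ → α → Bool),
      H z = ∑ b, ∑ c : κ → Bool, if z.1 i = b ∧ (fun j => z.2 j i) = c then H z else 0 := by
    intro z
    have inner : ∀ b : Bool, (∑ c : κ → Bool, if z.1 i = b ∧ (fun j => z.2 j i) = c then H z else 0)
        = if z.1 i = b then H z else 0 := by
      intro b
      by_cases hb : z.1 i = b
      · simp only [hb, true_and, if_true]
        rw [Finset.sum_ite_eq]
        simp
      · simp [hb]
    simp_rw [inner]
    rcases Bool.eq_false_or_eq_true (z.1 i) with h1 | h1 <;> simp [h1]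
  have reindex : ∀ (b : Bool) (c : κ → Bool),
      ∑ z : (α → Bool) × (κ → α → Bool), (if z.1 i = b ∧ (fun j => z.2 j i) = c then H z else 0) =
        ∑ z : (α → Bool) × (κ → α → Bool),
          if z.1 i = false ∧ (fun j => z.2 j i) = (fun _ => false) then H (upd i z b c) else 0 := by
    intro b c
    rw [← Finset.sum_filter, ← Finset.sum_filter]
    symm
    refine Finset.sum_nbij' (fun z => upd i z b c) (fun z => upd i z false (fun _ => false))
      ?_ ?_ ?_ ?_ ?_
    · intro z hz
      simp [Finset.mem_filter, upd_fst, upd_snd, update_self]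
    · intro z hz
      simp [Finset.mem_filter, upd_fst, upd_snd, update_self]
    · intro z hz
      obtain ⟨h1, h2⟩ := (Finset.mem_filter.1 hz).2
      rw [upd_upd]
      exact upd_eq_self h1 (fun j => congrFun h2 j)
    · intro z hz
      obtain ⟨h1, h2⟩ := (Finset.mem_filter.1 hz).2
      rw [upd_upd]
      exact upd_eq_self h1 (fun j => congrFun h2 j)
    · intro z hz
      rfl
  calc ∑ z, H z
      = ∑ z, ∑ b, ∑ c : κ → Bool, if z.1 i = b ∧ (fun j => z.2 j i) = c then H z else 0 :=
        Finset.sum_congr rfl fun z _ => fiber z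
    _ = ∑ b, ∑ z : (α → Bool) × (κ → α → Bool), ∑ c : κ → Bool,
          if z.1 i = b ∧ (fun j => z.2 j i) = c then H z else 0 := Finset.sum_comm
    _ = ∑ b, ∑ c : κ → Bool, ∑ z : (α → Bool) × (κ → α → Bool),
          if z.1 i = b ∧ (fun j => z.2 j i) = c then H z else 0 :=
        Finset.sum_congr rfl fun b _ => Finset.sum_comm
    _ = ∑ b, ∑ c : κ → Bool, ∑ z : (α → Bool) × (κ → α → Bool),
          if z.1 i = false ∧ (fun j => z.2 j i) = (fun _ => false) then H (upd i z b c) else 0 :=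
        Finset.sum_congr rfl fun b _ => Finset.sum_congr rfl fun c _ => reindex b c
    _ = ∑ b, ∑ z : (α → Bool) × (κ → α → Bool), ∑ c : κ → Bool,
          if z.1 i = false ∧ (fun j => z.2 j i) = (fun _ => false) then H (upd i z b c) else 0 :=
        Finset.sum_congr rfl fun b _ => Finset.sum_comm
    _ = ∑ z : (α → Bool) × (κ → α → Bool), ∑ b, ∑ c : κ → Bool,
          if z.1 i = false ∧ (fun j => z.2 j i) = (fun _ => false) then H (upd i z b c) else 0 :=
        Finset.sum_comm
    _ = _ := by
        refine Finset.sum_congr rfl fun z _ => ?_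
        split_ifs <;> simp

/-- **The block comparison** (Baron–Kahn's Claim, case `Ω_1 = {0,1}`): on the block
`{0,1} × {0,1}^κ` with product weight `wt(b) ∏_j wt(c_j) · m`, let `F` vanishing at `b = 0`
unless (i) applies, and `G`, be sub-weights such that (i) `F` charging a point with `b = 0` forces `G` to be full, and
(ii) `F` charging a point with `b = 1` forces `G` to be full, or full on a cylinder `{c_{j₀} = 1}`.
Then `Σ F ≤ Σ G` — the swap `(b, c) ↦ (c_{j₀}, c[j₀ ↦ b])` preserves the weight and carries
`{b = 1}` onto `{c_{j₀} = 1}`. [cite: BaronKahn2019, §2 (Proof of Claim)] -/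
theorem block_four_point {wt : Bool → ℝ} {m : ℝ} {F G : Bool → (κ → Bool) → ℝ}
    (hF : ∀ b c, 0 ≤ F b c ∧ F b c ≤ wt b * (∏ j, wt (c j)) * m)
    (hG : ∀ b c, 0 ≤ G b c ∧ G b c ≤ wt b * (∏ j, wt (c j)) * m)
    (h0 : (∃ c, F false c ≠ 0) → ∀ b c, G b c = wt b * (∏ j, wt (c j)) * m)
    (h1 : (∃ c, F true c ≠ 0) → (∀ b c, G b c = wt b * (∏ j, wt (c j)) * m) ∨
      ∃ j₀, ∀ b c, c j₀ = true → G b c = wt b * (∏ j, wt (c j)) * m) :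
    ∑ b, ∑ c, F b c ≤ ∑ b, ∑ c, G b c := by
  by_cases hA : ∃ c, F false c ≠ 0
  · have hg := h0 hA
    exact Finset.sum_le_sum fun b _ => Finset.sum_le_sum fun c _ => (hg b c).symm ▸ (hF b c).2
  · push Not at hA
    by_cases hB : ∃ c, F true c ≠ 0
    · -- `F` lives on `b = true`: `Σ F ≤ Σ_c full(true, c)`
      have hL : ∑ b, ∑ c, F b c ≤ ∑ c : κ → Bool, wt true * (∏ j, wt (c j)) * m := by
        rw [Fintype.sum_bool, Finset.sum_congr rfl fun c (_ : c ∈ univ) => hA c, Finset.sum_const_zero,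
          add_zero]
        exact Finset.sum_le_sum fun c _ => (hF true c).2
      refine hL.trans ?_
      rcases h1 hB with hg | ⟨j₀, hg⟩
      · rw [Fintype.sum_bool, Finset.sum_congr rfl fun c (_ : c ∈ univ) => hg true c]
        have : 0 ≤ ∑ c : κ → Bool, G false c := Finset.sum_nonneg fun c _ => (hG false c).1
        linarith
      · -- the swap bijection `(b, c) ↦ (c j₀, c[j₀ ↦ b])`
        have hfull : ∀ b (c : κ → Bool), wt (c j₀) * (∏ j, wt (update c j₀ b j)) * m =
            wt b * (∏ j, wt (c j)) * m := by
          intro b c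
          have h1 := Literature.Probability.Percolation.bkCube_prod_update (fun _ : κ => wt) c j₀ b
          have h2 := Finset.mul_prod_erase (univ : Finset κ) (fun j => wt (c j))
            (Finset.mem_univ j₀)
          rw [h1, ← h2]
          ring
        calc ∑ c : κ → Bool, wt true * (∏ j, wt (c j)) * m
            = ∑ b, ∑ c : κ → Bool, if b = true then wt b * (∏ j, wt (c j)) * m else 0 := by
              rw [Fintype.sum_bool]; simp
          _ = ∑ p : Bool × (κ → Bool), if p.1 = true then wt p.1 * (∏ j, wt (p.2 j)) * m else 0 := by
              rw [Fintype.sum_prod_type]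
          _ = ∑ p : Bool × (κ → Bool),
                if p.2 j₀ = true then wt p.1 * (∏ j, wt (p.2 j)) * m else 0 := by
              -- reindex by the involution `e p = (p.2 j₀, update p.2 j₀ p.1)`
              refine Finset.sum_nbij' (fun p => (p.2 j₀, update p.2 j₀ p.1))
                (fun p => (p.2 j₀, update p.2 j₀ p.1)) ?_ ?_ ?_ ?_ ?_
              · intro p _; exact Finset.mem_univ _
              · intro p _; exact Finset.mem_univ _
              · intro p _
                refine Prod.ext ?_ ?_
                · simp
                · funext j
                  by_cases hj : j = j₀
                  · subst hj; simp
                  · simp [update_of_ne hj]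
              · intro p _
                refine Prod.ext ?_ ?_
                · simp
                · funext j
                  by_cases hj : j = j₀
                  · subst hj; simp
                  · simp [update_of_ne hj]
              · intro p _
                simp only [update_self]
                split_ifs with h
                · rw [hfull]
                · rfl
          _ = ∑ b, ∑ c : κ → Bool, if c j₀ = true then wt b * (∏ j, wt (c j)) * m else 0 := by
              rw [Fintype.sum_prod_type]
          _ ≤ ∑ b, ∑ c, G b c := by
              refine Finset.sum_le_sum fun b _ => Finset.sum_le_sum fun c _ => ?_
              split_ifs with h
              · exact (hg b c h).symm.le
              · exact (hG b c).1
    · push Not at hB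
      refine Finset.sum_le_sum fun b _ => Finset.sum_le_sum fun c _ => ?_
      cases b
      · rw [hA c]; exact (hG false c).1
      · rw [hB c]; exact (hG true c).1

/-! ### The one-coordinate step (the printed Claim) -/

omit [Fintype α] [DecidableEq α] [Fintype κ] [DecidableEq κ] in
/-- The hybrid event reads the shared copy only off `M` and the private copies only on `M`.
[cite: BaronKahn2019, §2 ("apart from irrelevant variables, B_j is a copy of A_j")] -/
theorem mem_hybrid_of_agree {A : κ → Set (α → Bool)} {r : ℕ} {M : Finset α}
    {z z' : (α → Bool) × (κ → α → Bool)} (h1 : ∀ i, i ∉ M → z.1 i = z'.1 i)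
    (h2 : ∀ j i, i ∈ M → z.2 j i = z'.2 j i) (hz : z ∈ hybrid A r M) : z' ∈ hybrid A r M := by
  obtain ⟨I, hr, K, hKA, hKle, hdisj⟩ := hz
  exact ⟨I, hr, K, hKA, fun j hj i hK => ⟨fun hm => (h2 j i hm) ▸ (hKle j hj i hK).1 hm,
    fun hn => (h1 i hn) ▸ (hKle j hj i hK).2 hn⟩, hdisj⟩

omit [Fintype α] [Fintype κ] [DecidableEq κ] in
/-- Before privatising `i ∉ M`, the hybrid event does not read the private bits at `i`.
[cite: BaronKahn2019, §2 (Proof of Claim)] -/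
theorem upd_mem_hybrid_iff_of_notMem {A : κ → Set (α → Bool)} {r : ℕ} {M : Finset α} {i : α}
    (hi : i ∉ M) (z : (α → Bool) × (κ → α → Bool)) (b : Bool) (c c' : κ → Bool) :
    upd i z b c ∈ hybrid A r M ↔ upd i z b c' ∈ hybrid A r M := by
  have h2 : ∀ (c c' : κ → Bool) (j : κ) (i' : α), i' ∈ M →
      (upd i z b c).2 j i' = (upd i z b c').2 j i' := by
    intro c c' j i' hi'
    have hne : i' ≠ i := fun h => hi (h ▸ hi')
    simp only [upd_snd, update_of_ne hne]
  exact ⟨mem_hybrid_of_agree (fun _ _ => rfl) (h2 c c'), mem_hybrid_of_agree (fun _ _ => rfl) (h2 c' c)⟩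

omit [Fintype α] [Fintype κ] [DecidableEq κ] in
/-- After privatising `i`, the hybrid event does not read the shared bit at `i`.
[cite: BaronKahn2019, §2 (Proof of Claim)] -/
theorem upd_mem_hybrid_insert_iff {A : κ → Set (α → Bool)} {r : ℕ} {M : Finset α} {i : α}
    (z : (α → Bool) × (κ → α → Bool)) (b b' : Bool) (c : κ → Bool) :
    upd i z b c ∈ hybrid A r (insert i M) ↔ upd i z b' c ∈ hybrid A r (insert i M) := by
  have h1 : ∀ (b b' : Bool) (i' : α), i' ∉ insert i M →
      (upd i z b c).1 i' = (upd i z b' c).1 i' := by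
    intro b b' i' hi'
    have hne : i' ≠ i := fun h => hi' (h ▸ Finset.mem_insert_self i M)
    simp only [upd_fst, update_of_ne hne]
  exact ⟨mem_hybrid_of_agree (h1 b b') (fun _ _ _ => rfl),
    mem_hybrid_of_agree (h1 b' b) (fun _ _ _ => rfl)⟩

omit [Fintype α] [Fintype κ] [DecidableEq κ] in
/-- **Transfer of a witness family across the privatisation of `i`**: a family `(I, K)` witnessing
the old hybrid event at some value of the block keeps witnessing the new one at any block value whose
private bits are `1` wherever a member of the family uses coordinate `i`.
[cite: BaronKahn2019, §2 (Proof of Claim, the sets f_i)] -/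
theorem hybrid_transfer {A : κ → Set (α → Bool)} {r : ℕ} {M : Finset α} {i : α} (hi : i ∉ M)
    {z : (α → Bool) × (κ → α → Bool)} {b₀ : Bool} {c₀ : κ → Bool} {I : Finset κ}
    {K : κ → α → Bool} (hr : r ≤ I.card) (hKA : ∀ j ∈ I, K j ∈ A j)
    (hKle : ∀ j ∈ I, ∀ i', K j i' = true →
      (i' ∈ M → (upd i z b₀ c₀).2 j i' = true) ∧ (i' ∉ M → (upd i z b₀ c₀).1 i' = true))
    (hdisj : ∀ j ∈ I, ∀ j' ∈ I, j ≠ j' → ∀ i', i' ∉ M → K j i' = true → K j' i' = true → False)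
    {b : Bool} {c : κ → Bool} (hc : ∀ j ∈ I, K j i = true → c j = true) :
    upd i z b c ∈ hybrid A r (insert i M) := by
  refine ⟨I, hr, K, hKA, ?_, ?_⟩
  · intro j hj i' hK
    by_cases h : i' = i
    · subst h
      refine ⟨fun _ => ?_, fun hn => absurd (Finset.mem_insert_self i' M) hn⟩
      simp only [upd_snd, update_self]
      exact hc j hj hK
    · have old := hKle j hj i' hK
      simp only [upd_snd, upd_fst, update_of_ne h] at old ⊢
      exact ⟨fun hm => old.1 ((Finset.mem_insert.1 hm).resolve_left h),
        fun hn => old.2 fun hm => hn (Finset.mem_insert_of_mem hm)⟩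
  · intro j hj j' hj' hne i' hi'
    exact hdisj j hj j' hj' hne i' fun hm => hi' (Finset.mem_insert_of_mem hm)

omit [Fintype α] [Fintype κ] [DecidableEq κ] in
/-- Case (i) of the Claim: if the old event holds with the shared bit `0`, no witness uses
coordinate `i`, and the new event holds for every value of the block.
[cite: BaronKahn2019, §2 (Proof of Claim, "both sides are 1 if X_𝒜(y) ≥ r")] -/
theorem hybrid_step_false {A : κ → Set (α → Bool)} {r : ℕ} {M : Finset α} {i : α} (hi : i ∉ M)
    {z : (α → Bool) × (κ → α → Bool)} {c₀ : κ → Bool} (h : upd i z false c₀ ∈ hybrid A r M)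
    (b : Bool) (c : κ → Bool) : upd i z b c ∈ hybrid A r (insert i M) := by
  obtain ⟨I, hr, K, hKA, hKle, hdisj⟩ := h
  refine hybrid_transfer hi hr hKA hKle hdisj fun j hj hK => ?_
  have := (hKle j hj i hK).2 hi
  simp [upd_fst, update_self] at this

omit [Fintype α] [Fintype κ] [DecidableEq κ] in
/-- Case (ii) of the Claim: if the old event holds with the shared bit `1`, then either no witness
uses coordinate `i` (and the new event holds identically) or exactly one member `j₀` does (the
witnesses are disjoint off `M ∌ i`), and the new event holds whenever the private bit of `j₀` is `1`.
[cite: BaronKahn2019, §2 (Proof of Claim, the sets f_i)] -/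
theorem hybrid_step_true {A : κ → Set (α → Bool)} {r : ℕ} {M : Finset α} {i : α} (hi : i ∉ M)
    {z : (α → Bool) × (κ → α → Bool)} {c₀ : κ → Bool} (h : upd i z true c₀ ∈ hybrid A r M) :
    (∀ (b : Bool) (c : κ → Bool), upd i z b c ∈ hybrid A r (insert i M)) ∨
      ∃ j₀, ∀ (b : Bool) (c : κ → Bool), c j₀ = true → upd i z b c ∈ hybrid A r (insert i M) := by
  obtain ⟨I, hr, K, hKA, hKle, hdisj⟩ := h
  by_cases hex : ∃ j₀ ∈ I, K j₀ i = true
  · obtain ⟨j₀, hj₀, hK₀⟩ := hex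
    refine Or.inr ⟨j₀, fun b c hc => hybrid_transfer hi hr hKA hKle hdisj fun j hj hK => ?_⟩
    by_cases hjj : j = j₀
    · rw [hjj]; exact hc
    · exact (hdisj j hj j₀ hj₀ hjj i hi hK hK₀).elim
  · push Not at hex
    exact Or.inl fun b c => hybrid_transfer hi hr hKA hKle hdisj fun j hj hK => (hex j hj hK).elim

/-- **The coupling inequality of the chain**: privatising one more coordinate `i ∉ M` does not
decrease the weight of the hybrid event (Baron–Kahn: "it is enough to show
`μ(X_𝒜 ≥ r) ≤ μ*(X_ℬ ≥ r)`", proved through the conditional Claim). Proof: split along the block at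
`i` (`sum_block_split`) and compare blockwise (`block_four_point` fed by `hybrid_step_false`,
`hybrid_step_true`). [cite: BaronKahn2019, §2 (Proof of Theorem 1)] -/
theorem hybrid_sum_mono (w : α → Bool → ℝ) (hw : ∀ i b, 0 ≤ w i b) {A : κ → Set (α → Bool)}
    {r : ℕ} {M : Finset α} {i : α} (hi : i ∉ M) :
    ∑ z, (hybrid A r M).indicator
        (fun z : (α → Bool) × (κ → α → Bool) => (∏ i, w i (z.1 i)) * ∏ j, ∏ i, w i (z.2 j i)) z ≤
      ∑ z, (hybrid A r (insert i M)).indicator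
        (fun z : (α → Bool) × (κ → α → Bool) => (∏ i, w i (z.1 i)) * ∏ j, ∏ i, w i (z.2 j i)) z := by
  classical
  rw [sum_block_split i, sum_block_split i ((hybrid A r (insert i M)).indicator _)]
  refine Finset.sum_le_sum fun z _ => ?_
  split_ifs with hz
  · set m : ℝ := (∏ i' ∈ univ.erase i, w i' (z.1 i')) * ∏ j, ∏ i' ∈ univ.erase i, w i' (z.2 j i')
      with hm_def
    have hm : 0 ≤ m :=
      mul_nonneg (Finset.prod_nonneg fun i _ => hw i _)
        (Finset.prod_nonneg fun j _ => Finset.prod_nonneg fun i _ => hw i _)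
    have hval : ∀ (b : Bool) (c : κ → Bool),
        (∏ i', w i' ((upd i z b c).1 i')) * ∏ j, ∏ i', w i' ((upd i z b c).2 j i') =
          w i b * (∏ j, w i (c j)) * m := by
      intro b c
      simp only [upd_fst, upd_snd]
      rw [Literature.Probability.Percolation.bkCube_prod_update]
      have : ∀ j, ∏ i', w i' (update (z.2 j) i (c j) i') =
          w i (c j) * ∏ i' ∈ univ.erase i, w i' (z.2 j i') := fun j =>
        Literature.Probability.Percolation.bkCube_prod_update w (z.2 j) i (c j)
      simp_rw [this]
      rw [Finset.prod_mul_distrib, hm_def]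
      ring
    have hind : ∀ (T : Set ((α → Bool) × (κ → α → Bool))) (b : Bool) (c : κ → Bool),
        0 ≤ T.indicator (fun z : (α → Bool) × (κ → α → Bool) =>
            (∏ i, w i (z.1 i)) * ∏ j, ∏ i, w i (z.2 j i)) (upd i z b c) ∧
          T.indicator (fun z : (α → Bool) × (κ → α → Bool) =>
            (∏ i, w i (z.1 i)) * ∏ j, ∏ i, w i (z.2 j i)) (upd i z b c) ≤
            w i b * (∏ j, w i (c j)) * m := by
      intro T b c
      have h0 : 0 ≤ w i b * (∏ j, w i (c j)) * m :=
        mul_nonneg (mul_nonneg (hw i b) (Finset.prod_nonneg fun j _ => hw i _)) hm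
      by_cases hT : upd i z b c ∈ T
      · rw [Set.indicator_of_mem hT, hval]
        exact ⟨h0, le_rfl⟩
      · rw [Set.indicator_of_notMem hT]
        exact ⟨le_rfl, h0⟩
    refine block_four_point (hind _) (hind _) ?_ ?_
    · rintro ⟨c, hc⟩ b' c'
      have hmem := Set.mem_of_indicator_ne_zero hc
      rw [Set.indicator_of_mem (hybrid_step_false hi hmem b' c'), hval]
    · rintro ⟨c, hc⟩
      have hmem := Set.mem_of_indicator_ne_zero hc
      rcases hybrid_step_true hi hmem with h | ⟨j₀, h⟩
      · exact Or.inl fun b' c' => by rw [Set.indicator_of_mem (h b' c'), hval]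
      · exact Or.inr ⟨j₀, fun b' c' hc' => by rw [Set.indicator_of_mem (h b' c' hc'), hval]⟩
  · exact le_rfl

/-- Iterating the coupling inequality from `M = ∅` (Baron–Kahn's induction on `ψ`).
[cite: BaronKahn2019, §2 (Proof of Theorem 1, induction on ψ(𝒜))] -/
theorem hybrid_sum_empty_le (w : α → Bool → ℝ) (hw : ∀ i b, 0 ≤ w i b) {A : κ → Set (α → Bool)}
    {r : ℕ} (M : Finset α) :
    ∑ z, (hybrid A r ∅).indicator
        (fun z : (α → Bool) × (κ → α → Bool) => (∏ i, w i (z.1 i)) * ∏ j, ∏ i, w i (z.2 j i)) z ≤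
      ∑ z, (hybrid A r M).indicator
        (fun z : (α → Bool) × (κ → α → Bool) => (∏ i, w i (z.1 i)) * ∏ j, ∏ i, w i (z.2 j i)) z := by
  induction M using Finset.induction_on with
  | empty => exact le_rfl
  | insert k M hk ih => exact ih.trans (hybrid_sum_mono w hw hk)

/-- **Baron–Kahn's Theorem 1 on the weighted cube, coupling form.** For a finite coordinate type
`α`, finitely many increasing events `A j ⊆ {0,1}^α` (`j : κ`) and a product weight
`W(x) = ∏ᵢ wᵢ(xᵢ)`, `wᵢ ≥ 0`, with `W^{⊗κ}(y) = ∏_j W(y j)` on `κ` copies: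
`W({X ≥ r}) · W^{⊗κ}(Γ^κ) ≤ W(Γ) · W^{⊗κ}({Y ≥ r})`, where `{X ≥ r}` = "some `r` of the events occur
disjointly" and `{Y ≥ r}` = "`y j ∈ A j` for some `r` indices `j`". The two sides are the ends
`M = ∅`, `M = univ` of the chain `hybrid_sum_empty_le`. [cite: BaronKahn2019, Thm. 1] -/
theorem maxDisjoint_weight_le (w : α → Bool → ℝ) (hw : ∀ i b, 0 ≤ w i b) {A : κ → Set (α → Bool)}
    (hA : ∀ j, IsUpperSet (A j)) (r : ℕ) :
    (∑ x, (atLeastDisjoint A r).indicator (fun x : α → Bool => ∏ i, w i (x i)) x) *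
        ∑ y : κ → α → Bool, ∏ j, ∏ i, w i (y j i) ≤
      (∑ x : α → Bool, ∏ i, w i (x i)) *
        ∑ y, (atLeastCount A r).indicator (fun y : κ → α → Bool => ∏ j, ∏ i, w i (y j i)) y := by
  classical
  have key := hybrid_sum_empty_le w hw (A := A) (r := r) Finset.univ
  have hl : ∑ z, (hybrid A r ∅).indicator
      (fun z : (α → Bool) × (κ → α → Bool) => (∏ i, w i (z.1 i)) * ∏ j, ∏ i, w i (z.2 j i)) z =
      (∑ x, (atLeastDisjoint A r).indicator (fun x : α → Bool => ∏ i, w i (x i)) x) *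
        ∑ y : κ → α → Bool, ∏ j, ∏ i, w i (y j i) := by
    rw [Fintype.sum_prod_type, Finset.sum_mul]
    refine Finset.sum_congr rfl fun x _ => ?_
    rw [Finset.mul_sum]
    refine Finset.sum_congr rfl fun y _ => ?_
    simp only [Set.indicator_apply, mem_hybrid_empty]
    split_ifs <;> simp
  have hr : ∑ z, (hybrid A r Finset.univ).indicator
      (fun z : (α → Bool) × (κ → α → Bool) => (∏ i, w i (z.1 i)) * ∏ j, ∏ i, w i (z.2 j i)) z =
      (∑ x : α → Bool, ∏ i, w i (x i)) *
        ∑ y, (atLeastCount A r).indicator (fun y : κ → α → Bool => ∏ j, ∏ i, w i (y j i)) y := by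
    rw [Fintype.sum_prod_type, Finset.sum_mul_sum]
    refine Finset.sum_congr rfl fun x _ => Finset.sum_congr rfl fun y _ => ?_
    simp only [Set.indicator_apply, mem_hybrid_univ hA]
    split_ifs <;> simp
  rw [hl, hr] at key
  exact key

/-! ### Probability weights and the printed form -/

/-- The total weight of a product of sums: `Σ_x ∏ᵢ wᵢ(xᵢ) = ∏ᵢ (wᵢ(0) + wᵢ(1))`. [folklore] -/
theorem sum_prod_weight (w : α → Bool → ℝ) :
    ∑ x : α → Bool, ∏ i, w i (x i) = ∏ i, (w i false + w i true) := by
  have h := Finset.prod_univ_sum (fun _ : α => (univ : Finset Bool)) (fun i b => w i b)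
  rw [Fintype.piFinset_univ] at h
  rw [← h]
  exact Finset.prod_congr rfl fun i _ => by rw [Fintype.sum_bool, add_comm]

/-- The total weight of `κ` independent copies: `Σ_y ∏_j W(y j) = (Σ_x W(x))^{|κ|}`. [folklore] -/
theorem sum_copies_weight (W : (α → Bool) → ℝ) :
    ∑ y : κ → α → Bool, ∏ j, W (y j) = (∑ x : α → Bool, W x) ^ Fintype.card κ := by
  have h := Finset.prod_univ_sum (fun _ : κ => (univ : Finset (α → Bool))) (fun _ x => W x)
  rw [Fintype.piFinset_univ] at h
  rw [← h, Finset.prod_const, Finset.card_univ]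

/-- **Baron–Kahn's Theorem 1 on the cube, coupling form, probability weights**
(`wᵢ(0) + wᵢ(1) = 1`): `P(X ≥ r) ≤ P^{⊗κ}(Y ≥ r)` — the probability that some `r` of the increasing
events `A j` occur disjointly is at most the probability, for `κ` independent copies `y j` of the
configuration, that `y j ∈ A j` for some `r` indices `j`. [cite: BaronKahn2019, Thm. 1] -/
theorem maxDisjoint_le_count (w : α → Bool → ℝ) (hw : ∀ i b, 0 ≤ w i b)
    (hw1 : ∀ i, w i false + w i true = 1) {A : κ → Set (α → Bool)}
    (hA : ∀ j, IsUpperSet (A j)) (r : ℕ) :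
    ∑ x, (atLeastDisjoint A r).indicator (fun x : α → Bool => ∏ i, w i (x i)) x ≤
      ∑ y, (atLeastCount A r).indicator (fun y : κ → α → Bool => ∏ j, ∏ i, w i (y j i)) y := by
  have key := maxDisjoint_weight_le w hw hA r
  have h1 : ∑ x : α → Bool, ∏ i, w i (x i) = 1 := by
    rw [sum_prod_weight]
    exact Finset.prod_eq_one fun i _ => hw1 i
  have h2 : ∑ y : κ → α → Bool, ∏ j, ∏ i, w i (y j i) = 1 := by
    rw [sum_copies_weight (fun x : α → Bool => ∏ i, w i (x i)), h1, one_pow]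
  rw [h2, h1, mul_one, one_mul] at key
  exact key

omit [Fintype α] [DecidableEq α] [DecidableEq κ] in
/-- `y ∈ {Y ≥ r}` iff the set of indices `j` with `y j ∈ A j` has at least `r` elements. [folklore] -/
theorem mem_atLeastCount_iff {A : κ → Set (α → Bool)} [∀ j, DecidablePred (· ∈ A j)] {r : ℕ}
    {y : κ → α → Bool} :
    y ∈ atLeastCount A r ↔ r ≤ (univ.filter fun j => y j ∈ A j).card := by
  constructor
  · rintro ⟨I, hr, hI⟩
    exact hr.trans (Finset.card_le_card fun j hj => Finset.mem_filter.2 ⟨Finset.mem_univ j, hI j hj⟩)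
  · intro h
    exact ⟨univ.filter fun j => y j ∈ A j, h, fun j hj => (Finset.mem_filter.1 hj).2⟩

/-- **The law of `Y`** (independent indicators): for any weight `W` on the cube,
`Σ_y 1{Y(y) ≥ r} ∏_j W(y j) = Σ_{J ⊆ κ, |J| ≥ r} ∏_{j∈J} W(A j) · ∏_{j∉J} (W(Γ) - W(A j))`
(for probability weights: the Poisson-binomial tail `P(Y ≥ r)` with success probabilities `P(A j)`).
[cite: BaronKahn2019, Thm. 1 ("Y_1, …, Y_k independent Bernoullis with E Y_i = Pr(A_i), Y = Σ Y_i")] -/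
theorem sum_atLeastCount_eq (W : (α → Bool) → ℝ) (A : κ → Set (α → Bool)) (r : ℕ) :
    ∑ y, (atLeastCount A r).indicator (fun y : κ → α → Bool => ∏ j, W (y j)) y =
      ∑ J ∈ (univ : Finset (Finset κ)).filter (fun J => r ≤ J.card),
        (∏ j ∈ J, ∑ x, (A j).indicator W x) *
          ∏ j ∈ univ \ J, (∑ x, W x - ∑ x, (A j).indicator W x) := by
  classical
  -- the index set `J(y) = {j | y j ∈ A j}`
  set Js : (κ → α → Bool) → Finset κ := fun y => univ.filter fun j => y j ∈ A j with hJs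
  -- fibre over `J(y) = J`
  have hfib : ∀ J : Finset κ, ∑ y ∈ univ.filter (fun y => Js y = J), ∏ j, W (y j) =
      (∏ j ∈ J, ∑ x, (A j).indicator W x) *
        ∏ j ∈ univ \ J, (∑ x, W x - ∑ x, (A j).indicator W x) := by
    intro J
    have hmem : ∀ y : κ → α → Bool, Js y = J ↔ ∀ j, (y j ∈ A j ↔ j ∈ J) := by
      intro y
      rw [hJs, Finset.ext_iff]
      simp only [Finset.mem_filter, Finset.mem_univ, true_and]
    calc ∑ y ∈ univ.filter (fun y => Js y = J), ∏ j, W (y j)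
        = ∑ y : κ → α → Bool, if ∀ j, (y j ∈ A j ↔ j ∈ J) then ∏ j, W (y j) else 0 := by
          rw [Finset.sum_filter]
          exact Finset.sum_congr rfl fun y _ => by simp only [hmem y]
      _ = ∑ y : κ → α → Bool, ∏ j, (if (y j ∈ A j ↔ j ∈ J) then W (y j) else 0) := by
          refine Finset.sum_congr rfl fun y _ => ?_
          rw [Fintype.prod_ite_zero]
      _ = ∏ j, ∑ x : α → Bool, (if (x ∈ A j ↔ j ∈ J) then W x else 0) := by
          have h := Finset.prod_univ_sum (fun _ : κ => (univ : Finset (α → Bool)))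
            (fun j x => if (x ∈ A j ↔ j ∈ J) then W x else 0)
          rw [Fintype.piFinset_univ] at h
          exact h.symm
      _ = ∏ j, (if j ∈ J then ∑ x, (A j).indicator W x
            else ∑ x, W x - ∑ x, (A j).indicator W x) := by
          refine Finset.prod_congr rfl fun j _ => ?_
          by_cases hj : j ∈ J
          · simp only [hj, iff_true, if_true]
            exact Finset.sum_congr rfl fun x _ => (Set.indicator_apply (A j) W x).symm
          · simp only [hj, iff_false, if_false]
            rw [eq_sub_iff_add_eq, ← Finset.sum_add_distrib]
            refine Finset.sum_congr rfl fun x _ => ?_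
            rw [Set.indicator_apply]
            split_ifs <;> simp
      _ = _ := by
          rw [Finset.prod_ite, Finset.filter_univ_mem]
          congr 1
          refine Finset.prod_congr ?_ fun _ _ => rfl
          ext j
          simp
  -- sum over the fibres
  calc ∑ y, (atLeastCount A r).indicator (fun y : κ → α → Bool => ∏ j, W (y j)) y
      = ∑ y : κ → α → Bool, if r ≤ (Js y).card then ∏ j, W (y j) else 0 := by
        refine Finset.sum_congr rfl fun y _ => ?_
        rw [Set.indicator_apply]
        simp only [mem_atLeastCount_iff, hJs]
    _ = ∑ J : Finset κ, ∑ y ∈ univ.filter (fun y => Js y = J),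
          (if r ≤ (Js y).card then ∏ j, W (y j) else 0) :=
        (Finset.sum_fiberwise univ Js _).symm
    _ = ∑ J : Finset κ, if r ≤ J.card then
          ∑ y ∈ univ.filter (fun y => Js y = J), ∏ j, W (y j) else 0 := by
        refine Finset.sum_congr rfl fun J _ => ?_
        split_ifs with hJ
        · exact Finset.sum_congr rfl fun y hy => by
            rw [(Finset.mem_filter.1 hy).2]; simp [hJ]
        · exact Finset.sum_eq_zero fun y hy => by
            rw [(Finset.mem_filter.1 hy).2]; simp [hJ]
    _ = _ := by
        rw [← Finset.sum_filter]
        exact Finset.sum_congr rfl fun J _ => hfib J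

/-- **Baron–Kahn 2019, Theorem 1** (arXiv:1905.02883), the case `Ω_i = {0,1}` of the printed
statement "`X ≼ Y`": on the cube `{0,1}^α` (`α` finite) with the product probability weight
`W(x) = ∏ᵢ wᵢ(xᵢ)`, `wᵢ ≥ 0`, `wᵢ(0) + wᵢ(1) = 1`, for finitely many increasing events `A j` (`j : κ`)
and every `r`,
`P(some r of the A j occur disjointly) ≤ P(Y ≥ r) = Σ_{J ⊆ κ, |J| ≥ r} ∏_{j∈J} P(A j) ∏_{j∉J} (1 - P(A j))`,
`Y` a sum of independent Bernoullis with means `P(A j)`. For `|κ| = r = 2` this is the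
van den Berg–Kesten inequality (tree: `Literature.Probability.Percolation.bk_inequality_cube`).
[cite: BaronKahn2019, Thm. 1] -/
theorem BaronKahn2019_thm1 (w : α → Bool → ℝ) (hw : ∀ i b, 0 ≤ w i b)
    (hw1 : ∀ i, w i false + w i true = 1) {A : κ → Set (α → Bool)}
    (hA : ∀ j, IsUpperSet (A j)) (r : ℕ) :
    ∑ x, (atLeastDisjoint A r).indicator (fun x : α → Bool => ∏ i, w i (x i)) x ≤
      ∑ J ∈ (univ : Finset (Finset κ)).filter (fun J => r ≤ J.card),
        (∏ j ∈ J, ∑ x, (A j).indicator (fun x : α → Bool => ∏ i, w i (x i)) x) *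
          ∏ j ∈ univ \ J, (1 - ∑ x, (A j).indicator (fun x : α → Bool => ∏ i, w i (x i)) x) := by
  have key := maxDisjoint_le_count w hw hw1 hA r
  rw [sum_atLeastCount_eq (fun x : α → Bool => ∏ i, w i (x i)) A r] at key
  have h1 : ∑ x : α → Bool, ∏ i, w i (x i) = 1 := by
    rw [sum_prod_weight]
    exact Finset.prod_eq_one fun i _ => hw1 i
  rw [h1] at key
  exact key

end BaronKahn2019

end Literature.Probability.LatticeModels
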